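import Summits.QuantumFields.YangMills.Theorems.SwapVirialDeficitBlowUpGnomonicTrFibreJets
import Summits.QuantumFields.YangMills.Theorems.SwapVirialDeficitQuantitativeLaplaceRayMinorant
import HarnessLib

/-!
# STUB (S-001-good) OF SKELETON ➎: THE HESSIAN FAMILY, UNIFORM COERCIVITY, CUBIC DATUM AND AMPLITUDE OF THE RESCALED 001 FIBRES — the `hA hcoer hAm hρ hf hw hη`
# SOCKETS of ✓`laplaceMethod_quantitative_fibred_chart_cubic_offBound_on` for `Ψ(u, y) = gnoFibreTrEquiv (u, gnoScaleTr u y)`, UNIFORM OVER THE WHOLE BASE `ℝ²`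
# (free-hands support of ⟨stmt-QuantumFields-24197⟩ `SwapVirialDeficit.SwapGluedStiffness`; cell ym-idea-1; twin of w2 g59's ✓`bFibre_rescaled_sockets`; assembler fcl-p3 g48)

* §1 `contDiff_trScaledChart` (`(u, y) ↦ Ψ(u, y)` is `C^∞` JOINTLY — rotation by `−arctan u₂`, scalings `√(1+uᵢ²)`), `contDiff_trFibre_rescaled_uncurry`;
* §2 ★★ `exists_trFibreHessian (ε)` — SYMMETRIC operators `A u : V_B →ₗ V_B` (base `u ∈ ℝ²`) with `⟪A u y, y⟫ = D²(F₁∘Ψ(u,·))(0)[y,y]`, the RAY identity, joint measurability of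
  `(u,y) ↦ ⟪A u y,y⟫` (✓`measurable_inner_of_eq_fibreHessianForm`), `|⟪A u y, y⟫| ≤ 39984L⁴‖y‖²`;
* §3 ★ `trFibreHessian_base_cubic` (good signs): `|F₁(Ψ(u,y)) − ½⟪A u y, y⟫| ≤ 1136016L⁴‖y‖³` for EVERY `u, y` — `u`-UNIFORM (K7g);
* §4 ★★ `trFibreHessian_coercive`: `‖y‖²∕(5408(1+|Fol L|)L⁶) ≤ ⟪A u y, y⟫` for EVERY `u, y` and EVERY sign pattern (w3 g67's ✓`tr001_global_floor` read as `‖y‖²` by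
  ✓`tr001_rescaledNormSq_eq`, then the smooth minorant `s²‖y‖²(1 − s²‖y‖²)∕P ≤ F₁(Ψ(u, s·y))` and ✓`iteratedDeriv_two_ge_of_minorant` ∕ ✓`iteratedDeriv_two_sq_mul`);
* §5 ★★★ `trFibre_rescaled_sockets (ε) (hz) (hF)` — ONE existential package: `A`, `ρ′(u,y) := F₁(Ψ(u,y)) − ½⟪A u y,y⟫`, `e′(y) := g(y) − 1`: symmetric, measurable, ray identity,
  UNIFORM coercivity, `hf` identity, `|ρ′| ≤ 1136016L⁴‖y‖³`, amplitude `(Π|cᵢ(u)|)·J(Ψ(u,y))·1 = w₀(u)(1 + e′)` with `w₀(u) = (1+u₁²)⁻¹(1+u₂²)⁻¹`, `|e′| ≤ 2R‖y‖` on `‖y‖ ≤ R`.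

HONEST LABEL: calculus ∕ linear-algebra bookkeeping; the 001 fibred LAW, its reading on `chartMeasure L`, the log law, thresholds and `stub_h001_good` are OPEN, as are
(S-core-tip), (S-core-end), ⟨24197⟩ ∕ ⟨24194⟩; item of record ⟨24085⟩ SubOctaveBounded aside ∕ untouched; the Yang–Mills mass gap is NOT proved; no summit is proved by a
line.  THEOREMS ONLY (0 `def`, 0 `sorry`), standard axioms, no instances.  Seat ym-line-fcl-p3 g48 (cell ym-idea-1, free hands), `--supports stmt-QuantumFields-24197`.
References: [cite: Luscher1983, §2]; [cite: HasenpflugRudolfSprungk2024, §3.1 Assumption 2]; [cite: Breitung1994, §2.3 Definitions 4–5]; [folklore].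
-/

set_option autoImplicit false
set_option synthInstance.maxSize 1024

noncomputable section

open MeasureTheory Quaternion Set Metric
open scoped BigOperators Quaternion InnerProductSpace ContDiff
open Literature.MathematicalPhysics.QuantumFieldTheory hiding SU2
open Literature.MathematicalPhysics.QuantumLattice

namespace Summit.QuantumFields.YangMills.Theorems.SwapVirialDeficit.BlowUpRing

open Summit.QuantumFields.YangMills.Theorems.FemtoTransferGap
open Summit.QuantumFields.YangMills.Theorems.FemtoTransferGap.TT
open Summit.QuantumFields.YangMills.Theorems.VirialFluxGap.RingDeficit
open Summit.QuantumFields.YangMills.Theorems.SwapVirialDeficit.SwapRing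
open Summit.QuantumFields.YangMills.Theorems.SwapVirialDeficit.Gnomonic (normSq3 normSq3_nonneg gnomonicWeight piWeight)
open Summit.QuantumFields.YangMills.Theorems.QuantitativeLaplace (cubicDatum_of_third iteratedFDeriv_two_eq_lineJet exists_hessianOperator measurable_inner_of_eq_fibreHessianForm
  iteratedDeriv_two_ge_of_minorant contDiff_sq_mul iteratedDeriv_two_sq_mul)
open Summit.QuantumFields.YangMills.Theorems.SwapVirialDeficit.SectorLaplace (z₁ uJ sectorChar norm_uJ)

variable {L : ℕ} [NeZero L]

/-! ## §1 The rescaled 001 chart is jointly smooth -/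

/-- ★ **`(u, y) ↦ Ψ(u, y) = gnoFibreTrEquiv (u, gnoScaleTr u y)` IS `C^n` JOINTLY** (coordinates, `√(1+uᵢ²)`, `cos∕sin ∘ arctan`). [folklore] -/
theorem contDiff_trScaledChart {n : ℕ∞} : ContDiff ℝ n fun q : (ℝ × ℝ) × GnoFibreB L => gnoFibreTrEquiv (q.1, gnoScaleTr q.1 q.2) := by
  have hcoord : ∀ i : GnoFibreBIdx L, ContDiff ℝ n fun q : (ℝ × ℝ) × GnoFibreB L => q.2 i := fun i =>
    (EuclideanSpace.proj i : EuclideanSpace ℝ (GnoFibreBIdx L) →L[ℝ] ℝ).contDiff.comp contDiff_snd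
  have hu1 : ContDiff ℝ n fun q : (ℝ × ℝ) × GnoFibreB L => q.1.1 := contDiff_fst.comp contDiff_fst
  have hu2 : ContDiff ℝ n fun q : (ℝ × ℝ) × GnoFibreB L => q.1.2 := contDiff_snd.comp contDiff_fst
  have hc1 : ContDiff ℝ n fun q : (ℝ × ℝ) × GnoFibreB L => Real.sqrt (1 + q.1.1 ^ 2) :=
    (contDiff_const.add (hu1.pow 2)).sqrt fun q => by positivity
  have hc2 : ContDiff ℝ n fun q : (ℝ × ℝ) × GnoFibreB L => Real.sqrt (1 + q.1.2 ^ 2) :=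
    (contDiff_const.add (hu2.pow 2)).sqrt fun q => by positivity
  have hθ : ContDiff ℝ n fun q : (ℝ × ℝ) × GnoFibreB L => -Real.arctan q.1.2 := (Real.contDiff_arctan.comp hu2).neg
  have hcos : ContDiff ℝ n fun q : (ℝ × ℝ) × GnoFibreB L => Real.cos (-Real.arctan q.1.2) := Real.contDiff_cos.comp hθ
  have hsin : ContDiff ℝ n fun q : (ℝ × ℝ) × GnoFibreB L => Real.sin (-Real.arctan q.1.2) := Real.contDiff_sin.comp hθ
  have e : (fun q : (ℝ × ℝ) × GnoFibreB L => gnoFibreTrEquiv (q.1, gnoScaleTr q.1 q.2)) = fun q : (ℝ × ℝ) × GnoFibreB L =>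
      ((q.2 (Sum.inl (Sum.inl 0)),
        (((rotX (-Real.arctan q.1.2) (![Real.sqrt (1 + q.1.1 ^ 2) * q.2 (Sum.inl (Sum.inl 1)), q.1.1, Real.sqrt (1 + q.1.1 ^ 2) * q.2 (Sum.inl (Sum.inl 2))] : Fin 3 → ℝ),
            (![q.1.2, Real.sqrt (1 + q.1.2 ^ 2) * q.2 (Sum.inl (Sum.inr 0)), Real.sqrt (1 + q.1.2 ^ 2) * q.2 (Sum.inl (Sum.inr 1))] : Fin 3 → ℝ)),
          ((fun k => q.2 (Sum.inr (Sum.inl k))), (fun f k => q.2 (Sum.inr (Sum.inr (f, k)))))) : GnoCoord L)) : ℝ × GnoCoord L) :=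
    funext fun q => gnoFibreTrEquiv_gnoScaleTr q.1 q.2
  rw [e]
  refine (hcoord _).prodMk (ContDiff.prodMk (ContDiff.prodMk ?_ ?_) (ContDiff.prodMk (contDiff_pi.2 fun k => hcoord _)
    (contDiff_pi.2 fun f => contDiff_pi.2 fun k => hcoord _)))
  · refine contDiff_pi.2 fun k => ?_
    fin_cases k
    · show ContDiff ℝ n fun q : (ℝ × ℝ) × GnoFibreB L => Real.sqrt (1 + q.1.1 ^ 2) * q.2 (Sum.inl (Sum.inl 1))
      exact hc1.mul (hcoord _)
    · show ContDiff ℝ n fun q : (ℝ × ℝ) × GnoFibreB L =>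
        Real.cos (-Real.arctan q.1.2) * q.1.1 - Real.sin (-Real.arctan q.1.2) * (Real.sqrt (1 + q.1.1 ^ 2) * q.2 (Sum.inl (Sum.inl 2)))
      exact (hcos.mul hu1).sub (hsin.mul (hc1.mul (hcoord _)))
    · show ContDiff ℝ n fun q : (ℝ × ℝ) × GnoFibreB L =>
        Real.sin (-Real.arctan q.1.2) * q.1.1 + Real.cos (-Real.arctan q.1.2) * (Real.sqrt (1 + q.1.1 ^ 2) * q.2 (Sum.inl (Sum.inl 2)))
      exact (hsin.mul hu1).add (hcos.mul (hc1.mul (hcoord _)))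
  · refine contDiff_pi.2 fun k => ?_
    fin_cases k
    · exact hu2
    · show ContDiff ℝ n fun q : (ℝ × ℝ) × GnoFibreB L => Real.sqrt (1 + q.1.2 ^ 2) * q.2 (Sum.inl (Sum.inr 0))
      exact hc2.mul (hcoord _)
    · show ContDiff ℝ n fun q : (ℝ × ℝ) × GnoFibreB L => Real.sqrt (1 + q.1.2 ^ 2) * q.2 (Sum.inl (Sum.inr 1))
      exact hc2.mul (hcoord _)

/-- ★ `(u, y) ↦ F₁(Ψ(u, y))` is `C^n` JOINTLY. [cite: Luscher1983, §2] -/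
theorem contDiff_trFibre_rescaled_uncurry (ε : GnoSign L) {n : ℕ∞} :
    ContDiff ℝ n fun q : (ℝ × ℝ) × GnoFibreB L =>
      trGnoDeficit uJ z₁ (sectorChar z₁) (hubAt (gnoFibreTrEquiv (q.1, gnoScaleTr q.1 q.2)).1 1) ε (gnoFibreTrEquiv (q.1, gnoScaleTr q.1 q.2)).2 :=
  (contDiff_trDeficit (n := n) ε).comp contDiff_trScaledChart

/-! ## §2 The Hessian operator family of the rescaled 001 fibres -/

/-- ★★ **THE HESSIAN OPERATORS OF THE RESCALED 001 FIBRES.**  For every sign pattern `ε` there is a family `A : ℝ × ℝ → V_B →ₗ[ℝ] V_B` (indexed by the base `u`) of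
SYMMETRIC operators with the form identity `⟪A u y, y⟫ = D²(F₁∘Ψ(u,·))(0)[y,y]`, the RAY identity `⟪A u y, y⟫ = (d²∕ds²) F₁(Ψ(u, s·y))|₀`, the joint MEASURABILITY of
`(u, y) ↦ ⟪A u y, y⟫`, and the bound `|⟪A u y, y⟫| ≤ 39984L⁴‖y‖²`. [cite: Luscher1983, §2] [cite: HasenpflugRudolfSprungk2024, §3.1 Assumption 2] -/
theorem exists_trFibreHessian (ε : GnoSign L) :
    ∃ A : ℝ × ℝ → GnoFibreB L →ₗ[ℝ] GnoFibreB L,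
      (∀ u, (A u).IsSymmetric) ∧
      (∀ u (y : GnoFibreB L), ⟪A u y, y⟫_ℝ =
        iteratedFDeriv ℝ 2 (fun y' : GnoFibreB L =>
          trGnoDeficit uJ z₁ (sectorChar z₁) (hubAt (gnoFibreTrEquiv (u, gnoScaleTr u y')).1 1) ε (gnoFibreTrEquiv (u, gnoScaleTr u y')).2) 0 (fun _ => y)) ∧
      (∀ u (y : GnoFibreB L), ⟪A u y, y⟫_ℝ =
        iteratedDeriv 2 (fun s : ℝ =>
          trGnoDeficit uJ z₁ (sectorChar z₁) (hubAt (gnoFibreTrEquiv (u, gnoScaleTr u (s • y))).1 1) ε (gnoFibreTrEquiv (u, gnoScaleTr u (s • y))).2) 0) ∧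
      (Measurable fun q : (ℝ × ℝ) × GnoFibreB L => ⟪A q.1 q.2, q.2⟫_ℝ) ∧
      (∀ u (y : GnoFibreB L), |⟪A u y, y⟫_ℝ| ≤ 39984 * (L : ℝ) ^ 4 * ‖y‖ ^ 2) := by
  have h2 : (2 : WithTop ℕ∞) ≤ 2 := le_rfl
  have hex := fun u : ℝ × ℝ => exists_hessianOperator ((contDiff_trFibre_rescaled (n := 2) ε u).contDiffAt (x := (0 : GnoFibreB L))) h2
  choose A hAs hAyw hAyy using hex
  have hray : ∀ u (y : GnoFibreB L), ⟪A u y, y⟫_ℝ = iteratedDeriv 2 (fun s : ℝ =>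
      trGnoDeficit uJ z₁ (sectorChar z₁) (hubAt (gnoFibreTrEquiv (u, gnoScaleTr u (s • y))).1 1) ε (gnoFibreTrEquiv (u, gnoScaleTr u (s • y))).2) 0 := fun u y => by
    rw [hAyy, iteratedFDeriv_two_eq_lineJet (contDiff_trFibre_rescaled (n := 2) ε u) 0 y]
    simp only [zero_add]
  refine ⟨A, hAs, hAyy, hray, ?_, fun u y => ?_⟩
  · have h2' : (2 : WithTop ℕ∞) ≤ ((2 : ℕ∞) : WithTop ℕ∞) := le_rfl
    exact measurable_inner_of_eq_fibreHessianForm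
      (G := fun q : (ℝ × ℝ) × GnoFibreB L =>
        trGnoDeficit uJ z₁ (sectorChar z₁) (hubAt (gnoFibreTrEquiv (q.1, gnoScaleTr q.1 q.2)).1 1) ε (gnoFibreTrEquiv (q.1, gnoScaleTr q.1 q.2)).2)
      (contDiff_trFibre_rescaled_uncurry (n := 2) ε) h2' (M := ℝ × ℝ) (ι := id) continuous_id (ys := fun _ => (0 : GnoFibreB L)) continuous_const
      (A := fun u y => A u y) (B := fun _ y => y) (fun u y => hAyy u y)
  · rw [hAyy]; exact trFibre_rescaled_second_bound ε u 0 y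

/-! ## §3 The cubic datum at the base (good sign patterns), `u`-uniform -/

/-- ★ **THE CUBIC DATUM OF THE RESCALED 001 FIBRES**: `|F₁(Ψ(u, y)) − ½⟪A u y, y⟫| ≤ 1136016L⁴‖y‖³` for EVERY base point `u` and EVERY `y` (✓`cubicDatum_of_third`
with the `u`-uniform third bound ✓`trFibre_rescaled_third_bound`, flat ∕ critical base). [cite: Luscher1983, §2] -/
theorem trFibreHessian_base_cubic (ε : GnoSign L) (hz : ε.2.1 = true) (hF : ε.2.2 = fun _ => true)
    {A : ℝ × ℝ → GnoFibreB L →ₗ[ℝ] GnoFibreB L}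
    (hAyy : ∀ u (y : GnoFibreB L), ⟪A u y, y⟫_ℝ =
      iteratedFDeriv ℝ 2 (fun y' : GnoFibreB L =>
        trGnoDeficit uJ z₁ (sectorChar z₁) (hubAt (gnoFibreTrEquiv (u, gnoScaleTr u y')).1 1) ε (gnoFibreTrEquiv (u, gnoScaleTr u y')).2) 0 (fun _ => y))
    (u : ℝ × ℝ) (y : GnoFibreB L) :
    |trGnoDeficit uJ z₁ (sectorChar z₁) (hubAt (gnoFibreTrEquiv (u, gnoScaleTr u y)).1 1) ε (gnoFibreTrEquiv (u, gnoScaleTr u y)).2 - (1 / 2) * ⟪A u y, y⟫_ℝ| ≤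
      1136016 * (L : ℝ) ^ 4 * ‖y‖ ^ 3 := by
  have h := cubicDatum_of_third (R := ‖y‖) (A₃ := 6816096 * (L : ℝ) ^ 4) (contDiff_trFibre_rescaled (n := 3) ε u)
    (trFibre_rescaled_base_apply_zero ε hz hF u) (fderiv_trFibre_rescaled_base_eq_zero ε hz hF u) (fun z₀ _ w => trFibre_rescaled_third_bound ε u z₀ w) y le_rfl
  rw [← hAyy] at h
  refine h.trans (le_of_eq ?_)
  ring

/-! ## §4 Uniform coercivity from w3 g67's global floor -/

/-- ★★ **UNIFORM COERCIVITY OF THE 001 FIBRE HESSIAN**: `‖y‖²∕(5408·(1+|Fol L|)·L⁶) ≤ ⟪A u y, y⟫` for EVERY base point `u ∈ ℝ²`, EVERY `y`, EVERY sign pattern — the ray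
second derivative dominates that of the smooth minorant `s ↦ s²·(‖y‖² − s²‖y‖⁴)∕P ≤ min(s²‖y‖², 1)∕P ≤ F₁(Ψ(u, s·y))` (✓`tr001_global_floor` ∘ ✓`tr001_rescaledNormSq_eq`,
`P = 10816(1+|Fol L|)L⁶`). [cite: Luscher1983, §2] -/
theorem trFibreHessian_coercive (ε : GnoSign L) (hz : ε.2.1 = true) (hF : ε.2.2 = fun _ => true) {A : ℝ × ℝ → GnoFibreB L →ₗ[ℝ] GnoFibreB L}
    (hray : ∀ u (y : GnoFibreB L), ⟪A u y, y⟫_ℝ =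
      iteratedDeriv 2 (fun s : ℝ =>
        trGnoDeficit uJ z₁ (sectorChar z₁) (hubAt (gnoFibreTrEquiv (u, gnoScaleTr u (s • y))).1 1) ε (gnoFibreTrEquiv (u, gnoScaleTr u (s • y))).2) 0)
    (u : ℝ × ℝ) (y : GnoFibreB L) :
    ‖y‖ ^ 2 / (5408 * (1 + (Fintype.card (Fol L) : ℝ)) * (L : ℝ) ^ 6) ≤ ⟪A u y, y⟫_ℝ := by
  set P : ℝ := 10816 * (1 + (Fintype.card (Fol L) : ℝ)) * (L : ℝ) ^ 6 with hP
  have hL : (0 : ℝ) < L := by exact_mod_cast NeZero.pos L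
  have hP0 : 0 < P := by positivity
  -- the ray and its smooth minorant `s² · h(s)`
  set φ : ℝ → ℝ := fun s => trGnoDeficit uJ z₁ (sectorChar z₁) (hubAt (gnoFibreTrEquiv (u, gnoScaleTr u (s • y))).1 1) ε (gnoFibreTrEquiv (u, gnoScaleTr u (s • y))).2
    with hφ
  set h : ℝ → ℝ := fun s => (‖y‖ ^ 2 - s ^ 2 * ‖y‖ ^ 4) / P with hh
  have hφd : ContDiff ℝ ∞ φ := (contDiff_trFibre_rescaled (n := ⊤) ε u).comp (contDiff_id.smul contDiff_const)
  have hhd : ContDiff ℝ ∞ h := (contDiff_const.sub ((contDiff_id.pow 2).mul contDiff_const)).div_const P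
  have hmin : ∀ s, s ^ 2 * h s ≤ φ s := fun s => by
    have hfl := tr001_global_floor (L := L) (gnoFibreTrEquiv (u, gnoScaleTr u (s • y))).1 ε (gnoFibreTrEquiv (u, gnoScaleTr u (s • y))).2
    rw [tr001_rescaledNormSq_eq, norm_smul, mul_pow, Real.norm_eq_abs, sq_abs] at hfl
    -- `t − t² ≤ min(t, 1)` for `t = s²‖y‖²`
    have ht : s ^ 2 * ‖y‖ ^ 2 - (s ^ 2 * ‖y‖ ^ 2) ^ 2 ≤ min (s ^ 2 * ‖y‖ ^ 2) 1 :=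
      le_min (by nlinarith [sq_nonneg (s ^ 2 * ‖y‖ ^ 2)]) (by nlinarith [sq_nonneg (s ^ 2 * ‖y‖ ^ 2 - 1 / 2)])
    have e : s ^ 2 * h s = (s ^ 2 * ‖y‖ ^ 2 - (s ^ 2 * ‖y‖ ^ 2) ^ 2) / P := by rw [hh]; ring
    rw [e, div_le_iff₀ hP0]
    have hφs : φ s = trGnoDeficit uJ z₁ (sectorChar z₁) (hubAt (gnoFibreTrEquiv (u, gnoScaleTr u (s • y))).1 1) ε (gnoFibreTrEquiv (u, gnoScaleTr u (s • y))).2 := rfl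
    rw [hφs]
    calc s ^ 2 * ‖y‖ ^ 2 - (s ^ 2 * ‖y‖ ^ 2) ^ 2 ≤ min (s ^ 2 * ‖y‖ ^ 2) 1 := ht
      _ ≤ P * trGnoDeficit uJ z₁ (sectorChar z₁) (hubAt (gnoFibreTrEquiv (u, gnoScaleTr u (s • y))).1 1) ε (gnoFibreTrEquiv (u, gnoScaleTr u (s • y))).2 := by
          rw [hP]; exact hfl
      _ = trGnoDeficit uJ z₁ (sectorChar z₁) (hubAt (gnoFibreTrEquiv (u, gnoScaleTr u (s • y))).1 1) ε (gnoFibreTrEquiv (u, gnoScaleTr u (s • y))).2 * P := mul_comm _ _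
  -- at `s = 0` both vanish (the base is flat for good sign patterns)
  have hφ0 : φ 0 = 0 := by
    have h0 := trFibre_rescaled_base_apply_zero (L := L) ε hz hF u
    simp only at h0
    show trGnoDeficit uJ z₁ (sectorChar z₁) (hubAt (gnoFibreTrEquiv (u, gnoScaleTr u ((0 : ℝ) • y))).1 1) ε (gnoFibreTrEquiv (u, gnoScaleTr u ((0 : ℝ) • y))).2 = 0
    rw [zero_smul]; exact h0
  have h0 : (fun s : ℝ => s ^ 2 * h s) 0 = φ 0 := by simp [hφ0]
  have key := iteratedDeriv_two_ge_of_minorant hφd (contDiff_sq_mul hhd) hmin h0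
  have h2 : (2 : WithTop ℕ∞) ≤ ∞ := by norm_cast
  rw [iteratedDeriv_two_sq_mul (hhd.of_le h2)] at key
  have eh0 : h 0 = ‖y‖ ^ 2 / P := by simp [hh]
  rw [eh0] at key
  rw [hray u y]
  have e2 : ‖y‖ ^ 2 / (5408 * (1 + (Fintype.card (Fol L) : ℝ)) * (L : ℝ) ^ 6) = 2 * (‖y‖ ^ 2 / P) := by
    rw [hP]; field_simp; ring
  rw [e2]
  exact key

/-! ## §5 The sockets, packaged -/

/-- The `u`-free fibre weight of ✓`trDensity_rescaled_eq` is the `μ_B`-density at the direction `gnoFibreTrEmb 0 y` (angle `0`: `rotX 0 = id`). [folklore] -/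
theorem trFibreWeight_eq_emb_zero (y : GnoFibreB L) :
    ((1 + y (Sum.inl (Sum.inl 0)) ^ 2)⁻¹) ^ 2 *
        (gnomonicWeight (![y (Sum.inl (Sum.inl 1)), 0, y (Sum.inl (Sum.inl 2))] : Fin 3 → ℝ) *
          gnomonicWeight (![0, y (Sum.inl (Sum.inr 0)), y (Sum.inl (Sum.inr 1))] : Fin 3 → ℝ) *
          gnomonicWeight (fun k => y (Sum.inr (Sum.inl k))) * piWeight (fun f k => y (Sum.inr (Sum.inr (f, k))))) =
      ((1 + (gnoFibreTrEmb 0 y).1 ^ 2)⁻¹) ^ 2 * gnoDensity (gnoFibreTrEmb 0 y).2 := by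
  rw [gnoFibreTrEmb_apply]
  simp only [gnoDensity, Real.arctan_zero, neg_zero, rotX_zero]

/-- ★★★ **THE 001 SOCKETS (one existential), UNIFORM OVER THE WHOLE BASE `ℝ²`**: good sign patterns; operators `A u` on `V_B` (symmetric, `(u,y) ↦ ⟪A u y,y⟫` measurable, the RAY
identity), UNIFORM coercivity `‖y‖²∕(5408(1+|Fol L|)L⁶) ≤ ⟪A u y,y⟫`, the cubic datum `F₁(Ψ(u,y)) − 0 = ½⟪A u y,y⟫ + ρ′(u,y)`, `ρ′` measurable, `|ρ′(u,y)| ≤ 1136016L⁴‖y‖³`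
(`u`-UNIFORM), and the amplitude `(Π|cᵢ(u)|)·J(Ψ(u,y))·1 = w₀(u)(1 + e′(u,y))`, `w₀(u) = (1+u₁²)⁻¹(1+u₂²)⁻¹`, `e′` measurable, `|e′| ≤ 2R‖y‖` on `‖y‖ ≤ R` — the
`hA hcoer hAm hρm hem hf hρ hw hη` of ✓`laplaceMethod_quantitative_fibred_chart_cubic_offBound_on` for `Ψ`, base set `S = univ`.
[cite: Luscher1983, §2] [cite: HasenpflugRudolfSprungk2024, §3.1 Assumption 2] [cite: Breitung1994, §2.3 Definitions 4–5] -/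
theorem trFibre_rescaled_sockets (ε : GnoSign L) (hz : ε.2.1 = true) (hF : ε.2.2 = fun _ => true) :
    ∃ A : ℝ × ℝ → GnoFibreB L →ₗ[ℝ] GnoFibreB L, ∃ ρ' e' : (ℝ × ℝ) × GnoFibreB L → ℝ,
      (∀ u, (A u).IsSymmetric) ∧
      (Measurable fun q : (ℝ × ℝ) × GnoFibreB L => ⟪A q.1 q.2, q.2⟫_ℝ) ∧ Measurable ρ' ∧ Measurable e' ∧
      (∀ u (y : GnoFibreB L), ⟪A u y, y⟫_ℝ =
        iteratedDeriv 2 (fun s : ℝ =>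
          trGnoDeficit uJ z₁ (sectorChar z₁) (hubAt (gnoFibreTrEquiv (u, gnoScaleTr u (s • y))).1 1) ε (gnoFibreTrEquiv (u, gnoScaleTr u (s • y))).2) 0) ∧
      (∀ u (y : GnoFibreB L), (5408 * (1 + (Fintype.card (Fol L) : ℝ)) * (L : ℝ) ^ 6)⁻¹ * ‖y‖ ^ 2 ≤ ⟪A u y, y⟫_ℝ) ∧
      (∀ u (y : GnoFibreB L),
        trGnoDeficit uJ z₁ (sectorChar z₁) (hubAt (gnoFibreTrEquiv (u, gnoScaleTr u y)).1 1) ε (gnoFibreTrEquiv (u, gnoScaleTr u y)).2 - 0 =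
          (1 / 2) * ⟪A u y, y⟫_ℝ + ρ' (u, y)) ∧
      (∀ u (y : GnoFibreB L), |ρ' (u, y)| ≤ 1136016 * (L : ℝ) ^ 4 * ‖y‖ ^ 3) ∧
      (∀ u (y : GnoFibreB L), (∏ i, |gnoFibreTrScale (L := L) u i|) *
          (((1 + (gnoFibreTrEquiv (u, gnoScaleTr u y)).1 ^ 2)⁻¹) ^ 2 * gnoDensity (gnoFibreTrEquiv (u, gnoScaleTr u y)).2) * 1 =
        (1 + u.1 ^ 2)⁻¹ * (1 + u.2 ^ 2)⁻¹ * (1 + e' (u, y))) ∧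
      (∀ R : ℝ, 0 ≤ R → ∀ u (y : GnoFibreB L), ‖y‖ ≤ R → |e' (u, y)| ≤ (2 * R) * ‖y‖) := by
  obtain ⟨A, hAs, hAyy, hray, hAm, -⟩ := exists_trFibreHessian (L := L) ε
  refine ⟨A,
    fun q => trGnoDeficit uJ z₁ (sectorChar z₁) (hubAt (gnoFibreTrEquiv (q.1, gnoScaleTr q.1 q.2)).1 1) ε (gnoFibreTrEquiv (q.1, gnoScaleTr q.1 q.2)).2 -
      (1 / 2) * ⟪A q.1 q.2, q.2⟫_ℝ,
    fun q => ((1 + (gnoFibreTrEmb 0 q.2).1 ^ 2)⁻¹) ^ 2 * gnoDensity (gnoFibreTrEmb 0 q.2).2 - 1, hAs, hAm, ?_, ?_, hray, fun u y => ?_, fun u y => by ring,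
    fun u y => trFibreHessian_base_cubic ε hz hF hAyy u y, fun u y => ?_, fun R hR u y hy => ?_⟩
  · -- measurability of `ρ′`
    have hchart : Measurable fun q : (ℝ × ℝ) × GnoFibreB L => gnoFibreTrEquiv (q.1, gnoScaleTr q.1 q.2) :=
      (gnoFibreTrEquiv (L := L)).measurable.comp (measurable_fst.prodMk (measurable_gnoScaleTr_prod (L := L)))
    have hFm : Measurable fun q : (ℝ × ℝ) × GnoFibreB L =>
        trGnoDeficit uJ z₁ (sectorChar z₁) (hubAt (gnoFibreTrEquiv (q.1, gnoScaleTr q.1 q.2)).1 1) ε (gnoFibreTrEquiv (q.1, gnoScaleTr q.1 q.2)).2 :=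
      (contDiff_trDeficit (n := 0) ε).continuous.measurable.comp hchart
    exact hFm.sub (measurable_const.mul hAm)
  · -- measurability of `e′`
    have h := Measurable.comp measurable_bDensity ((gnoFibreTrEmb (L := L) 0).continuous.measurable.comp (measurable_snd : Measurable fun q : (ℝ × ℝ) × GnoFibreB L => q.2))
    exact h.sub measurable_const
  · -- uniform coercivity
    have h := trFibreHessian_coercive ε hz hF hray u y
    rw [div_eq_inv_mul] at h
    exact h
  · -- `hw`: the amplitude factorises
    obtain ⟨hw0, -, -, -⟩ := trBaseWeight_facts
    rw [prod_abs_gnoFibreTrScale, trDensity_rescaled_eq, trFibreWeight_eq_emb_zero, ← hw0 u]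
    ring
  · -- `hη`: the amplitude defect
    obtain ⟨h1, h2, -⟩ := trFibreWeight_bounds (L := L) y
    rw [trFibreWeight_eq_emb_zero] at h1 h2
    rw [abs_le]
    have hy0 := norm_nonneg y
    constructor <;> nlinarith [mul_le_mul_of_nonneg_left hy (by positivity : (0 : ℝ) ≤ 2 * ‖y‖)]

end Summit.QuantumFields.YangMills.Theorems.SwapVirialDeficit.BlowUpRing

end
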